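import Literature.AlgebraicGeometry.Motives.MumfordTateInvariants
import Literature.AlgebraicGeometry.Motives.MumfordTateInvariantsStable
import Literature.AlgebraicGeometry.Motives.MumfordTateInvariantsXiHodge
import Literature.AlgebraicGeometry.Motives.MumfordTateInvariantsSubHodge
import Literature.AlgebraicGeometry.Motives.HodgeStructureSemisimple
import HarnessLib

/-!
# Proof of `Deligne1982_mumfordTateInvariants`

Discharge of the named fact `HodgeStructure.Deligne1982_mumfordTateInvariants`
(`Literature/AlgebraicGeometry/Motives/MumfordTateInvariants.lean`): for a polarizable pure
`ℚ`-Hodge structure `H` on a finite-dimensional `V` and its Mumford–Tate group of RATIONAL points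
`MT(H)(ℚ) = H.mumfordTateGroup`,

(i) a weight-`0` rational tensor fixed by `MT(H)(ℚ)` is a Hodge class of type `(0,0)`;
(ii) every `MT(H)(ℚ)`-stable subspace `W ≤ T^{a,b}` has an `MT(H)(ℚ)`-stable complement.

Sources: P. Deligne, *Hodge cycles on abelian varieties* (notes by J. S. Milne), LNM 900 (1982),
I §3, Prop. 3.4 (with its proof: "`t` is of type `(0,0)` iff it is fixed by `μ(𝔾ₘ)`, equivalently
by `cl(μ) = G`") and Prop. 3.6 ("if `V` is polarizable then `G` is reductive", proof:
`T = W ⊕ W^⊥`); M. Green, P. Griffiths, M. Kerr, *Mumford–Tate groups and domains* (2012),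
(I.B.1), (I.B.5), (I.B.6).

## The proof as formalised (the descent to `ℚ`-points)

The printed proofs concern the algebraic group `MT = cl(μ)`; its statements descend to
`ℚ`-points because `MT(ℚ)` is Zariski dense (Borel 1991, 18.3). Lacking algebraic groups over
`ℚ` in Mathlib, the files `MumfordTateInvariants*.lean` replace density by EXPLICIT rational
points: with `𝔰 ⊆ End_ℚ V` the Lie algebra of the stabiliser of the Hodge tensors
(`lieStabilizer`), (a) the Hodge grading operator `Θ` lies in `ℂ ⊗ 𝔰`
(`gradingEnd_mem_span_lieStabilizer`, Deligne's "`μ(𝔾ₘ) ⊆ G`" infinitesimally), so a non-Hodge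
tensor is moved by some `X ∈ 𝔰`; (b) the Jordan parts of `X` lie in `𝔰`; a nilpotent `N ∈ 𝔰`
exponentiates to the rational unipotent `exp N ∈ MT(ℚ)` and a semisimple `S ∈ 𝔰` yields, via
norm-one units of the splitting field of its minimal polynomial descended by Galois theory,
rational elements `P₀(S) ∈ MT(ℚ)` of the torus through `S` realising prescribed characters
(`exists_torusElement`) — this proves (i) (`mem_hodgeClasses_of_forall_mumfordTateGroup`) and that
`MT(ℚ)`-stable subspaces are `𝔰`-stable, hence sub-Hodge structures
(`exists_subHodgeStructure_of_mumfordTateGroup_stable`, GGK (I.B.5)); (c) for (ii), `Q` induces a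
polarization `Q_T` of `T^{a,b} H` (`Polarization.tensorSpace`, via an `h`-orthonormal graded
basis), the tree's semisimplicity theorem (`SubHodgeStructure.exists_isCompl_eq_orthogonal`,
Voisin 2002, Lemma 7.26) gives `T^{a,b} = W ⊕ W^{⊥}`, and `W^{⊥}` is `MT(ℚ)`-stable because
`MT(ℚ)` acts by similitudes of `Q` (`Polarization.exists_similitude_of_mem_mumfordTateGroup`,
from the Hodge tensor `Q^∨ ⊗ Q ∈ T^{2,2}`; Deligne I 3.6 proof, GGK (I.B.6)).

## References

* [Deligne1982HodgeCycles] P. Deligne, Hodge cycles on abelian varieties, LNM 900 (1982), I §3,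
  Prop. 3.4, 3.6.
* [GreenGriffithsKerr2012] M. Green, P. Griffiths, M. Kerr, Mumford–Tate groups and domains,
  Ann. of Math. Stud. 183 (2012), (I.B.1), (I.B.5), (I.B.6).
* [VoisinHodgeI2002] C. Voisin, Hodge Theory and Complex Algebraic Geometry I (2002), Lemma 7.26.
* [Borel1991] A. Borel, Linear Algebraic Groups, 2nd ed. (1991), 18.3 (the density statement that
  is circumvented here).
-/

noncomputable section

open scoped TensorProduct

namespace Literature.AlgebraicGeometry.Motives

namespace HodgeStructure

/-- **Deligne, *Hodge cycles on abelian varieties*, I, Prop. 3.4 (with proof) and Prop. 3.6,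
on rational points: Hodge tensors are exactly the `MT(H)(ℚ)`-invariants, and (for polarizable
`H`) `MT(H)(ℚ)`-stable subspaces of `T^{a,b}` have `MT(H)(ℚ)`-stable complements.**
[cite: Deligne1982HodgeCycles, I Prop. 3.4 (with proof) and Prop. 3.6] -/
theorem Deligne1982_mumfordTateInvariants_holds : Deligne1982_mumfordTateInvariants := by
  intro V _ _ _ _ n H hpol
  refine ⟨fun a b _ t ht => mem_hodgeClasses_of_forall_mumfordTateGroup H ht, fun a b W hW => ?_⟩
  obtain ⟨Q⟩ := hpol
  have hW' : ∀ g ∈ H.mumfordTateGroup, ∀ w ∈ W, tensorSpaceAct g w ∈ W :=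
    fun g hg w hw => hW g hg hw
  obtain ⟨S, hS⟩ := exists_subHodgeStructure_of_mumfordTateGroup_stable H W hW'
  classical
  haveI : Module.Finite ℚ (hodgeTensorSpace V a b) :=
    Module.Finite.of_basis (hodgeTensorBasis (Module.finBasis ℚ V) a b)
  obtain ⟨S', hS', hc⟩ := SubHodgeStructure.exists_isCompl_eq_orthogonal (Q.tensorSpace a b) S
  refine ⟨S'.toSubmodule, fun g hg y hy => ?_, hS ▸ hc⟩
  rw [Submodule.mem_comap, LinearEquiv.coe_coe, hS', Polarization.tensorSpace_form, hS]
  rw [hS', Polarization.tensorSpace_form, hS] at hy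
  exact Q.tensorSpaceAct_mem_orthogonal_of_stable W hW' hg hy

end HodgeStructure

end Literature.AlgebraicGeometry.Motives

end
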